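/-
Copyright (c) 2026. Released under the Apache 2.0 license.
-/
import Literature.NumberTheory.EllipticCurves.ManinConstantConductorLe300000
import Literature.NumberTheory.EllipticCurves.ManinConstantSemistablePrimewise
import Literature.NumberTheory.EllipticCurves.CuspFormLFunctionLevelConductorProofs
import Literature.NumberTheory.EllipticCurves.IsogenyCompProofs
import Mathlib.NumberTheory.Padics.PadicVal.Basic
import HarnessLib

/-!
# "The Manin constant of the optimal curve of the isogeny class of `E` is `±1`", as a PREDICATE —
# the per-class shape of the printed range theorem (Agashe–Ribet–Stein 2006, Thm. 2.6) and of a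
# Manin-constant certificate

Topic `Literature/NumberTheory/EllipticCurves`; namespace
`Literature.NumberTheory.EllipticCurves.ModularForms`. DEFINITIONS (predicates with a free curve
argument; nothing is asserted, no named fact is introduced) and PROVED API only.

## What is defined, and why

Every Manin-constant theorem typed in the tree is stated over the SAME rendering of "`E` is the
`X₀(N)`-optimal (strong Weil) curve with Manin constant `c`" (files
`ManinConstantSemistablePrimewise.lean`, `ManinConstantNonPotentiallyOrdinaryPrimes.lean`,
`ManinConstantKodairaTypePrimes.lean`, `AgasheRibetStein2006/ManinConstantOptimalCurves.lean`,
`ManinConstantConductorLe300000.lean`): a globally minimal model `W'/ℚ`, a parametrisation datum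
`D' : ModularParametrizationData W' N'` (`ModularCurve.lean`: newform `f`, Néron period pair `L` of
the model, an integer `c` with `c·Λ_f ⊆ Λ_{W'}`, the degree) and the LATTICE CLAUSE
`∀ z ∈ D'.L.lattice, ∃ w ∈ periodLattice D'.f, z = D'.c * w` (so `Λ_{W'} = c·Λ_f`,
`W' ≅ ℂ/Λ_f = E_f` is the optimal curve and `c = D'.maninConstant` is its Manin constant; Agashe–
Ribet–Stein 2006, §§1–2: "the optimal quotient associated to the newform `f` is
`E = J₀(N)/I_f J₀(N)`", "`φ_E^* ω = c · 2πi f(z) dz` … the Manin constant `c_E` of `E` is the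
absolute value `|c|`"; Manin 1971 §10.3 expects `c_E = 1`). The lattice clause is written out
verbatim below, as in those files (it is also the body of `ShuZhai2021.IsOptimalDatum` and
`Zhai2021.IsOptimalDatum`, by `Iff.rfl`; no third name is introduced). The printed RANGE
theorem (op. cit.
Thm. 2.6, Cremona: "If `E` is an optimal elliptic curve over `ℚ` with conductor at most `130000`,
then `c_E = 1`") is typed as the closed fact
`AgasheRibetStein2006.cremona_abs_maninConstant_eq_one_of_level_le`:
`∀ W' D', (lattice clause) → N' ≤ 130000 → |D'.maninConstant| = 1`.

This file names the CLASS-LOCAL instance of that sentence as a predicate of one curve `W`: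

* `IsOptimalModel W₀` — "`W₀` is a model of the `X₀(N)`-optimal curve of its class": some datum of
  `W₀` at the conductor level satisfies the lattice clause (the OPTIMALITY half of a row of
  Cremona's table `opt_man`, [Cre19] ¶2: "curve number 1 is the `Γ₀(N)`-optimal curve");
* `ClassAbsManinConstantEqOne W` — "the optimal curve of the isogeny class of `W` has Manin
  constant `±1`": for every
  globally minimal `W'` `ℚ`-isogenous to `W` and every datum `D'` of `W'` (any level) satisfying the
  lattice clause, `|D'.maninConstant| = 1` (the MANIN half of a table row, [Cre19] ¶ "Concerning
  the Manin constant": "the Manin constant is `1` for every optimal curve"; the statement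
  `c_π = 1` of Manin 1971 §10.3 as quoted by Česnavičius 2018, §1, for this one class);
* `OptimalCurveManinCertificate W₀ := IsOptimalModel W₀ ∧ ClassAbsManinConstantEqOne W₀` — the
  shape of ONE ROW "the `Γ₀(N)`-optimal curve of the class is `W₀` and its Manin constant is `1`"
  (what Cremona's completed full-space modular-symbol computation asserts per class, Agashe–Ribet–
  Stein 2006 appendix §5; and what an independent two-implementation recomputation certifies).

NOTHING here asserts `c = ±1` for any curve: the predicates are hypotheses to be
DISPLAYED on per-class theorems, exactly as `|D'.maninConstant| = 1` already is. What is PROVED: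
(i) the API turning the predicate into the binders the consumers carry
(`ClassAbsManinConstantEqOne.not_dvd_maninConstant`: `¬ (p : ℤ) ∣ D'.maninConstant` for EVERY prime
`p`; `…padicValInt_maninConstant_eq_zero`); (ii) class invariance
(`ClassAbsManinConstantEqOne.of_isIsogenous`); (iii) the three PRINTED sources of the predicate:
`classAbsManinConstantEqOne_of_conductorNorm_le` (Agashe–Ribet–Stein 2006 Thm. 2.6, `N_W ≤ 130000`,
from the fact `cremona_abs_maninConstant_eq_one_of_level_le`),
`classAbsManinConstantEqOne_of_conductorNorm_le_300000` (the same sentence at Cremona's bound as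
cited
by Česnavičius–Neururer–Saha 2024 §1, from `cremona_abs_maninConstant_eq_one_of_level_le_300000`),
and `classAbsManinConstantEqOne_of_squarefree_conductorNorm` (Česnavičius 2018 Thm. 1.2 "in
particular, if `E` is semistable then `c_π = ±1`", from the three prime-by-prime children
`mazur_…`, `abbesUllmo_…`, `cesnavicius_…` of `ManinConstantSemistablePrimewise.lean`), each
modulo the modularity fact `exists_isNewformOf` (used only to identify the level of a datum with
the conductor, `IsNewformOf.level_eq_conductorNorm_of_exists_isNewformOf`, and the conductor across
the class through the common newform, `IsNewformOf.of_isIsogenous`).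

Existence of the optimal curve in every class (some `W₀ ∼ W` with `IsOptimalModel W₀`) is the
Summit-side theorem `Summit.BirchSwinnertonDyer.Rank1Residual.X12.exists_isIsogenous_optimal`
(from `exists_optimal_modularParametrizationData_of_modularity`); it is not restated here.

## References
* [AgasheRibetStein2006] A. Agashe, K. Ribet, W. A. Stein, *The Manin constant*, Pure Appl. Math.
  Q. 2 (2006) 617–636: §§1–2 (optimal quotient, `c_E`, Manin's `c_E = 1`), Thm. 2.6 and appendix
  (J. E. Cremona) §5, Thm. 5.2.
* [Cremona2022ManinConstants] J. E. Cremona, *Manin constants and optimal curves*,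
  `ecdata/manin.txt`
  (= [Cre19] of Česnavičius–Neururer–Saha), ¶2 and ¶ "Concerning the Manin constant".
* [Cesnavicius2018] K. Česnavičius, *The Manin constant in the semistable case*, Compositio Math.
  154 (2018) 1889–1920 (arXiv:1703.02951), §1 (Manin 1971 §10.3 quoted) and Thm. 1.2.
* [CesnaviciusNeururerSaha2023] K. Česnavičius, M. Neururer, A. Saha, *The Manin constant and the
  modular degree*, J. Eur. Math. Soc. 26 (2024) 573–637, §1.
-/

noncomputable section

open scoped MatrixGroups ModularForm

open CongruenceSubgroup UpperHalfPlane WeierstrassCurve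

namespace Literature.NumberTheory.EllipticCurves.ModularForms

/-! ### The predicates -/

/-- **"`W₀` is a model of the `X₀(N)`-optimal (strong Weil) curve of its isogeny class"**: some
parametrisation datum of `W₀` at the conductor level `N = N(W₀)` satisfies the lattice clause
`Λ_{W₀} = c·Λ_f`. For a globally minimal `W₀` this is the statement "curve `W₀` is the
`Γ₀(N)`-optimal curve of its class" of Cremona's table ([Cre19] ¶2) / Agashe–Ribet–Stein 2006 §2.
A predicate; nothing asserted. [cite: AgasheRibetStein2006, §2 and appendix Thm. 5.2]
[cite: Cremona2022ManinConstants, ¶2] -/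
def IsOptimalModel (W₀ : WeierstrassCurve ℚ) : Prop :=
  ∃ (_ : NeZero (W₀.conductorNorm ℤ)) (D₀ : ModularParametrizationData W₀ (W₀.conductorNorm ℤ)),
    ∀ z ∈ D₀.L.lattice, ∃ w ∈ periodLattice D₀.f, z = D₀.c * w

/-- **"The Manin constant of the optimal curve of the isogeny class of `W` is `±1`"** (the
statement `c_π = 1` of Manin 1971 §10.3 for ONE class, in the words of Česnavičius 2018 §1: "For a
new elliptic optimal quotient `π : J₀(n) ↠ E`, … `c_π = 1`"; Agashe–Ribet–Stein 2006 §2: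
"`c_E = 1`"), rendered CLASS-LOCALLY in the shape of the printed range theorem
`AgasheRibetStein2006.cremona_abs_maninConstant_eq_one_of_level_le`
(there: `… → N' ≤ 130000 → |D'.maninConstant| = 1`): for every globally minimal model `W'` of a
curve `ℚ`-isogenous to `W`, every level `N'` and every parametrisation datum `D'` of `W'` at level
`N'` satisfying the lattice clause (`φ_{D'}` is the optimal parametrisation and
`D'.maninConstant` its Manin constant w.r.t. a Néron differential), `|D'.maninConstant| = 1`.
A predicate on `W` (any member of the class serves: `ClassAbsManinConstantEqOne.of_isIsogenous`);
NOTHING is asserted — this is the hypothesis a per-class theorem DISPLAYS, discharged in print for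
`N(W) ≤ 130000` (`classAbsManinConstantEqOne_of_conductorNorm_le`) and for squarefree `N(W)`
(`classAbsManinConstantEqOne_of_squarefree_conductorNorm`), by Cremona's table as cited in print for
`N(W) ≤ 300000` (`…_le_300000`), and otherwise by a certificate or not at all.
[cite: AgasheRibetStein2006, §2 and Thm. 2.6] [cite: Cesnavicius2018, §1 (arXiv:1703.02951)] -/
def ClassAbsManinConstantEqOne (W : WeierstrassCurve ℚ) : Prop :=
  ∀ (W' : WeierstrassCurve ℚ) [W'.IsElliptic] [W'.IsGloballyMinimal] {N' : ℕ} [NeZero N']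
    (D' : ModularParametrizationData W' N'), IsIsogenous W W' →
    (∀ z ∈ D'.L.lattice, ∃ w ∈ periodLattice D'.f, z = D'.c * w) → |D'.maninConstant| = 1

/-- **One row "the `Γ₀(N)`-optimal curve of the class is `W₀` and its Manin constant is `1`"** —
the shape of a line of Cremona's table (`opt_man` code `1` with `c = 1`, [Cre19]) and of a
two-implementation full-space modular-symbol certificate at level `N = N(W₀)` (Agashe–Ribet–Stein
2006, appendix §5, the method): `W₀` is a model of the optimal curve AND the optimal curve of its
class has Manin constant `±1`. A predicate; nothing asserted.
[cite: AgasheRibetStein2006, appendix §5 and Thm. 5.2]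
[cite: Cremona2022ManinConstants, ¶2 and ¶ "Concerning the Manin constant"] -/
def OptimalCurveManinCertificate (W₀ : WeierstrassCurve ℚ) : Prop :=
  IsOptimalModel W₀ ∧ ClassAbsManinConstantEqOne W₀

/-! ### API: from the predicate to the binders carried by consumers -/

namespace ClassAbsManinConstantEqOne

variable {W : WeierstrassCurve ℚ}

/-- Under `ClassAbsManinConstantEqOne W`: `|c| = 1` for every optimal datum of every globally
minimal member of the class (the definition, applied). [cite: AgasheRibetStein2006, §2] -/
theorem abs_maninConstant_eq_one (h : ClassAbsManinConstantEqOne W)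
    {W' : WeierstrassCurve ℚ} [W'.IsElliptic] [W'.IsGloballyMinimal] {N' : ℕ} [NeZero N']
    (D' : ModularParametrizationData W' N') (hiso : IsIsogenous W W')
    (hopt : ∀ z ∈ D'.L.lattice, ∃ w ∈ periodLattice D'.f, z = D'.c * w) :
    |D'.maninConstant| = 1 :=
  h W' D' hiso hopt

/-- **The Manin binder at EVERY prime at once.** Under `ClassAbsManinConstantEqOne W`, no prime
divides the Manin constant of an optimal datum of a globally minimal member of the class — the
hypothesis `hc : ¬ (p : ℤ) ∣ D'.maninConstant` of the Rank-`≤ 1` consumers, for all `p`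
simultaneously (proof word for word that of
`AgasheRibetStein2006.not_dvd_maninConstant_of_level_le`).
[cite: AgasheRibetStein2006, Thm. 2.6] -/
theorem not_dvd_maninConstant (h : ClassAbsManinConstantEqOne W)
    {W' : WeierstrassCurve ℚ} [W'.IsElliptic] [W'.IsGloballyMinimal] {N' : ℕ} [NeZero N']
    (D' : ModularParametrizationData W' N') (hiso : IsIsogenous W W')
    (hopt : ∀ z ∈ D'.L.lattice, ∃ w ∈ periodLattice D'.f, z = D'.c * w)
    {p : ℕ} (hp : p.Prime) : ¬ (p : ℤ) ∣ D'.maninConstant := by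
  intro hdvd
  have h1 : |D'.maninConstant| = 1 := h W' D' hiso hopt
  have h2 : (p : ℤ) ∣ 1 := h1 ▸ (dvd_abs _ _).mpr hdvd
  have h3 : (p : ℤ) = 1 := Int.eq_one_of_dvd_one (by positivity) h2
  exact hp.one_lt.ne' (by exact_mod_cast h3)

/-- The same in valuation form (`ord_p c = 0`, the record-side binder shape
`padicValInt p D.maninConstant = 0`). [cite: AgasheRibetStein2006, Thm. 2.6] -/
theorem padicValInt_maninConstant_eq_zero (h : ClassAbsManinConstantEqOne W)
    {W' : WeierstrassCurve ℚ} [W'.IsElliptic] [W'.IsGloballyMinimal] {N' : ℕ} [NeZero N']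
    (D' : ModularParametrizationData W' N') (hiso : IsIsogenous W W')
    (hopt : ∀ z ∈ D'.L.lattice, ∃ w ∈ periodLattice D'.f, z = D'.c * w)
    (p : ℕ) [hp : Fact p.Prime] : padicValInt p D'.maninConstant = 0 :=
  padicValInt.eq_zero_of_not_dvd (h.not_dvd_maninConstant D' hiso hopt hp.out)

/-- **Class invariance**: the predicate depends only on the `ℚ`-isogeny class — if it holds for
`W` and `W` is isogenous to `V`, it holds for `V` (transitivity of isogeny, `IsIsogenous.trans'`).
[cite: SilvermanAEC2009, III.4] -/
theorem of_isIsogenous (h : ClassAbsManinConstantEqOne W) {V : WeierstrassCurve ℚ}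
    (hWV : IsIsogenous W V) : ClassAbsManinConstantEqOne V :=
  fun W' _ _ _ _ D' hVW' hopt ↦ h W' D' (IsIsogenous.trans' hWV hVW') hopt

end ClassAbsManinConstantEqOne

/-! ### The three PRINTED sources of the predicate -/

section Sources

/-- Level bookkeeping: modulo the modularity fact `exists_isNewformOf`, the level `N'` of a
parametrisation datum of a curve `W'` isogenous to `W` is the conductor of `W` — the newform of
`W'` is a newform of `W` (`IsNewformOf.of_isIsogenous`: isogenous curves have the same `L`-series),
and a newform of `W` has level `N(W)` (`IsNewformOf.level_eq_conductorNorm_of_exists_isNewformOf`,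
strong multiplicity one). [cite: DiamondShurman2005, Thm. 8.8.1] [cite: Knapp1993, Thm. 11.67] -/
theorem level_eq_conductorNorm_of_isIsogenous (hnf : exists_isNewformOf)
    {W : WeierstrassCurve ℚ} [W.IsElliptic] {W' : WeierstrassCurve ℚ} [W'.IsElliptic]
    {N' : ℕ} [NeZero N'] (D' : ModularParametrizationData W' N') (hiso : IsIsogenous W W') :
    N' = W.conductorNorm ℤ :=
  IsNewformOf.level_eq_conductorNorm_of_exists_isNewformOf hnf (D'.isNewformOf.of_isIsogenous hiso)

/-- **Agashe–Ribet–Stein 2006, Thm. 2.6 (Cremona), per class.** Under the printed range fact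
`AgasheRibetStein2006.cremona_abs_maninConstant_eq_one_of_level_le` ("If `E` is an optimal elliptic
curve over `ℚ` with conductor at most `130000`, then `c_E = 1`") and modularity
(`exists_isNewformOf`, only to identify levels with the conductor), the predicate holds for (the
class of) every elliptic `W/ℚ` of conductor `N(W) ≤ 130000`.
[cite: AgasheRibetStein2006, Thm. 2.6] -/
theorem classAbsManinConstantEqOne_of_conductorNorm_le
    (h : AgasheRibetStein2006.cremona_abs_maninConstant_eq_one_of_level_le)
    (hnf : exists_isNewformOf) (W : WeierstrassCurve ℚ) [W.IsElliptic]
    (hN : W.conductorNorm ℤ ≤ 130000) : ClassAbsManinConstantEqOne W := by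
  intro W' _ _ N' _ D' hiso hopt
  have hN' : N' ≤ 130000 := (level_eq_conductorNorm_of_isIsogenous hnf D' hiso) ▸ hN
  exact h W' D' hopt hN'

/-- **Cremona's verification to `N ≤ 300000` as cited by Česnavičius–Neururer–Saha 2024 §1, per
class.** Under the fact `cremona_abs_maninConstant_eq_one_of_level_le_300000` (registry tier
PUB[sec]: a refereed sentence CITING the database note [Cre19]; referee A R84.2 keeps rows resting
on it LITERAL) and modularity, the predicate holds for every elliptic `W/ℚ` of conductor
`N(W) ≤ 300000`. Same proof as the previous theorem; recorded so that ONE predicate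
carries the printed range, the cited-database range and a certified range with different tier
words. [cite: CesnaviciusNeururerSaha2023, §1 (arXiv v3 text chunk 3 L70–72)] -/
theorem classAbsManinConstantEqOne_of_conductorNorm_le_300000
    (h : cremona_abs_maninConstant_eq_one_of_level_le_300000)
    (hnf : exists_isNewformOf) (W : WeierstrassCurve ℚ) [W.IsElliptic]
    (hN : W.conductorNorm ℤ ≤ 300000) : ClassAbsManinConstantEqOne W := by
  intro W' _ _ N' _ D' hiso hopt
  have hN' : N' ≤ 300000 := (level_eq_conductorNorm_of_isIsogenous hnf D' hiso) ▸ hN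
  exact h W' D' hopt hN'

/-- **Česnavičius 2018, Thm. 1.2 ("In particular, if `E` is semistable (i.e., if `n` is
squarefree), then `c_π = ±1`"), per class**, from its three prime-by-prime children
`mazur_not_dvd_maninConstant_of_odd` (odd `p`, `p² ∤ N'`),
`abbesUllmo_not_dvd_maninConstant_of_not_dvd_level` (`p ∤ N'`) and
`cesnavicius_not_two_dvd_maninConstant_of_two_dvd_level` (`2 ∥ N'`) of
`ManinConstantSemistablePrimewise.lean`, and modularity (levels = conductor): if the conductor
`N(W)` is squarefree, the predicate holds for `W` — at every prime `p`,
`p² ∤ N(W) = N'`, so no prime divides `c` (`abs_maninConstant_eq_one_of_forall_prime_not_dvd`).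
[cite: Cesnavicius2018, Thm. 1.2 (arXiv:1703.02951 §1, chunk p0003 L20–25)]
[cite: Mazur1978, Cor. 4.1] [cite: AbbesUllmo1996, Thm. A] -/
theorem classAbsManinConstantEqOne_of_squarefree_conductorNorm
    (hM : mazur_not_dvd_maninConstant_of_odd)
    (hAU : abbesUllmo_not_dvd_maninConstant_of_not_dvd_level)
    (hC : cesnavicius_not_two_dvd_maninConstant_of_two_dvd_level)
    (hnf : exists_isNewformOf) (W : WeierstrassCurve ℚ) [W.IsElliptic]
    (hsq : Squarefree (W.conductorNorm ℤ)) : ClassAbsManinConstantEqOne W := by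
  intro W' _ _ N' _ D' hiso hopt
  have hN' : N' = W.conductorNorm ℤ := level_eq_conductorNorm_of_isIsogenous hnf D' hiso
  refine D'.abs_maninConstant_eq_one_of_forall_prime_not_dvd fun p hp ↦ ?_
  have hp2 : ¬ p ^ 2 ∣ N' := fun hdvd ↦ by
    rw [hN'] at hdvd
    have := (Nat.squarefree_iff_prime_squarefree.mp hsq) p hp
    exact this (by simpa [pow_two] using hdvd)
  by_cases h2 : p = 2
  · subst h2
    by_cases hdvd : 2 ∣ N'
    · exact hC W' D' hopt hdvd hp2
    · exact hAU W' D' hopt 2 hp hdvd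
  · exact hM W' D' hopt p hp h2 hp2

end Sources

/-! ### API of the certificate row -/

namespace OptimalCurveManinCertificate

variable {W₀ : WeierstrassCurve ℚ}

/-- The optimality half of a certificate row. [cite: AgasheRibetStein2006, appendix Thm. 5.2] -/
theorem isOptimalModel (h : OptimalCurveManinCertificate W₀) : IsOptimalModel W₀ :=
  h.1

/-- The Manin half of a certificate row. [cite: AgasheRibetStein2006, Thm. 2.6] -/
theorem classAbsManinConstantEqOne (h : OptimalCurveManinCertificate W₀) :
    ClassAbsManinConstantEqOne W₀ :=
  h.2

/-- A certificate row for `W₀` is a certificate row's Manin half for every member of the class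
(`V` with `W₀ ∼ V`). [cite: AgasheRibetStein2006, Thm. 2.6] -/
theorem classAbsManinConstantEqOne_of_isIsogenous (h : OptimalCurveManinCertificate W₀)
    {V : WeierstrassCurve ℚ} (hiso : IsIsogenous W₀ V) : ClassAbsManinConstantEqOne V :=
  h.2.of_isIsogenous hiso

/-- **The strong-member binders from a certificate row.** For a globally minimal elliptic `W₀`
carrying a certificate row there is a parametrisation datum `D₀` of `W₀` at the conductor level
which is optimal (the lattice clause, the `hopt` binder of the Rank-`≤ 1` consumers), has
`|D₀.maninConstant| = 1`, and hence `¬ (p : ℤ) ∣ D₀.maninConstant` for EVERY prime `p` (the `hc`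
binder, all flagged primes at once). Reflexivity of isogeny (`isIsogenous_self`) feeds the class
predicate at `W₀` itself. [cite: AgasheRibetStein2006, §2 and Thm. 2.6] -/
theorem exists_optimalDatum_abs_maninConstant_eq_one [W₀.IsElliptic] [W₀.IsGloballyMinimal]
    (h : OptimalCurveManinCertificate W₀) :
    ∃ (_ : NeZero (W₀.conductorNorm ℤ)) (D₀ : ModularParametrizationData W₀ (W₀.conductorNorm ℤ)),
      (∀ z ∈ D₀.L.lattice, ∃ w ∈ periodLattice D₀.f, z = D₀.c * w) ∧ |D₀.maninConstant| = 1 ∧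
        ∀ p : ℕ, p.Prime → ¬ (p : ℤ) ∣ D₀.maninConstant := by
  obtain ⟨⟨hN, D₀, hopt⟩, hM⟩ := h
  haveI := hN
  have hself : IsIsogenous W₀ W₀ := isIsogenous_self W₀
  exact ⟨hN, D₀, hopt, hM W₀ D₀ hself hopt,
    fun p hp ↦ hM.not_dvd_maninConstant D₀ hself hopt hp⟩

end OptimalCurveManinCertificate

/-- **The printed range gives certificate rows**: under Agashe–Ribet–Stein 2006 Thm. 2.6 and
modularity, an optimal model `W₀` (`IsOptimalModel W₀`) of conductor `≤ 130000` carries a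
certificate row — the per-class restatement of "curve 1 is optimal and `c = 1`" in the printed range
(appendix Thm. 5.2 for `N < 60000`; Thm. 2.6 for `c_E = 1`, `N ≤ 130000`; the optimality input is
the hypothesis `hopt`). [cite: AgasheRibetStein2006, Thm. 2.6 and appendix Thm. 5.2] -/
theorem optimalCurveManinCertificate_of_conductorNorm_le
    (h : AgasheRibetStein2006.cremona_abs_maninConstant_eq_one_of_level_le)
    (hnf : exists_isNewformOf) (W₀ : WeierstrassCurve ℚ) [W₀.IsElliptic]
    (hopt : IsOptimalModel W₀) (hN : W₀.conductorNorm ℤ ≤ 130000) :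
    OptimalCurveManinCertificate W₀ :=
  ⟨hopt, classAbsManinConstantEqOne_of_conductorNorm_le h hnf W₀ hN⟩

end Literature.NumberTheory.EllipticCurves.ModularForms

end
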